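import Summits.QuantumFields.BalabanUV.Beta.FP.PerfectPolarization
import Summits.QuantumFields.BalabanUV.Beta.FP.HorizontalBookkeeping
import Summits.QuantumFields.BalabanUV.Beta.D1BFx.ReducedKernelSandwichLeg

/-!
# `BalabanUV.Beta.FP.FineHessianTransportTable` — road «FP» for binder row D1, ROW KER-γ (α2) sub-row α2-b PART 0 (owner memo `KER-GAMMA-ALPHA2.md` §2,
# R-FP-34): THE RIGHT MEMBER OF `hfine` IN THE SAME TWO-POINT-TABLE CURRENCY AS THE LEFT — for a translation-invariant leg and translation-covariant
# families the fine Hessian table at `(κ′,s),(l′,s′)` IS the reduced kernel at `s′ − s`, hence `N⁸·truncK (PiBF wg wgh V W v w) N c e (s′ − s)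
# = 𝟙[‖s′−s‖∞ ≤ N]·N⁸·( wg·fineHessA Pker V W c e s s′ − wgh·fineHessA G0ker v w c e s s′ )`

HONEST DEPENDENCY (page 1, mandatory): continuum YM on T⁴ ⇐ BetaPertH ∧ nine spine estimates (0/9 proved); BetaPertH ⇐ (D1) ∧ (D4) ∧ CAP+tail;
G-an2-4 gates asym, D1 and NE2/3/4.  HONEST FRAMING (cell contract, verbatim): «discharging `BetaPertH` makes Bałaban's UV stability UNCONDITIONAL —
a real constructive-QFT result; it is NOT the continuum limit and NOT the Clay problem.»  THIS MODULE DISCHARGES NOTHING of the wall: it is [folklore]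
bookkeeping (simultaneous-shift invariance of `bubble`∕`tadpole` — `ExpKernelCalculus.bubble_shiftK`∕`tadpole_shiftK`) and [our object] unfolding of
`PerfectPolarization.PiBF` (`Pker_translate`, `G0ker_translate`) and `HorizontalBookkeeping.truncK`.  No `def`, no `def … : Prop`, nothing cited, 0 sorry;
0∕4 row-D1 binders; NOT (α2), NOT hsplit, NOT D1, NOT BetaPertH, NOT continuum, NOT Clay.  «not in print; our bookkeeping».

ABSOLUTE RULE (cell charter, verbatim): «No internally-minted statement may enter as a cited fact. Every hypothesis is either kernel-proved in this package or a
verbatim quotation of a PUBLISHED theorem with page reference. The manuscript(s) under audit are NOT citable for their own disputed steps — they are the thing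
under adjudication; programme-internal (2001/route/tribunal) claims are never citable.»

WHY.  After `FineHessianBlockSplit` (α2-a part 1) the LEFT member of the junction's `hfine` (leaf-01-g11's (α0), `FineSplitJunction`) is a sum of fine
Hessian TABLES; this file writes the RIGHT member `N⁸·truncK PiBF N (s′ − s)` as fine Hessian tables at the SAME bond pair, so that the near piece
`(F − N⁸·PiBF(s′−s))·𝟙_{‖s′−s‖∞ ≤ N}` of `FineSplitJunctionNearFar` is a difference of tables word by word (gluon table vs `wg·fineHessA Pker V W`, ghost table
vs `wgh·fineHessA G0ker v w`) — the input shape of α2-b ∕ α2-c.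

WHAT.  §1 [folklore] `shiftK_of_cov` (a covariant family's member at `u` is the shift of its member at `0`), **`fineHessA_eq_hessKer_of_cov`**
(`(∀ v, shiftK v A = A)` + covariant `V`, `W` ⟹ `fineHessA A V W κ′ l′ u u′ = hessKer A V W κ′ l′ (u′ − u)`).  §2 [our object] **`PiBF_eq_fineHessA`**
(`PiBF … c e (s′ − s) = wg·fineHessA Pker V W c e s s′ − wgh·fineHessA G0ker v w c e s s′` for covariant data), **`truncK_PiBF_eq_fineHessA`** (the right member
of `hfine` with its window indicator and `N⁸` displayed).
Provenance: road FP OWNER b2b-balaban-beta-d1-p3 gen 9 (prover-b2b-balaban-beta-d1-p3-g9-0), 2026-08-21, sub-row α2-b part 0.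
-/

noncomputable section

namespace Summit.QuantumFields.BalabanUV.Beta.FP.FineHessianTransportTable

open Literature.MathematicalPhysics.QuantumFieldTheory.Balaban1983to89
open Literature.MathematicalPhysics.QuantumFieldTheory.Balaban1983to89.Beta
open ExpKernelCalculus (Site MKer bubble tadpole hessKer shiftK bubble_shiftK tadpole_shiftK)
open OneStepResolventKernel (Fib)
open DyadicShell (Pt supNorm)
open DressedMomentNormalisation (EKer)
open Summit.QuantumFields.BalabanUV.Beta.FP.PerfectPolarization (Pker G0ker PiBF PiBF_def Pker_translate G0ker_translate)
open Summit.QuantumFields.BalabanUV.Beta.FP.HorizontalBookkeeping (truncK truncK_apply)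
open Summit.QuantumFields.BalabanUV.Beta.D1BFx.DressedTablesLeg (tadpoleTableA bubbleTableA tadpoleTableA_apply bubbleTableA_apply)
open Summit.QuantumFields.BalabanUV.Beta.D1BFx.ReducedKernelSandwichLeg (fineHessA fineHessA_apply)

variable {F : Type*} [Fintype F]

/-! ## §1 Covariant families: the table is the reduced kernel -/

omit [Fintype F] in
/-- [folklore] `shiftK v (shiftK (−v) K) = K`. -/
theorem shiftK_shiftK_neg (v : Site 4) (K : MKer 4 F) : shiftK v (shiftK (-v) K) = K := by
  funext x y a b
  simp [shiftK]

omit [Fintype F] in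
/-- [folklore] a translation-covariant one-point family: `V μ u = shiftK (−u) (V μ 0)`. -/
theorem shiftK_of_cov {V : Fin 4 → Site 4 → MKer 4 F} (hcovV : ∀ (μ : Fin 4) (y t : Site 4), V μ (y + t) = shiftK (-t) (V μ y))
    (μ : Fin 4) (u : Site 4) : V μ u = shiftK (-u) (V μ 0) := by
  have h := hcovV μ 0 u; rwa [zero_add] at h

omit [Fintype F] in
/-- [folklore] a jointly translation-covariant two-point family: `W μ u ν u′ = shiftK (−u) (W μ 0 ν (u′ − u))`. -/
theorem shiftK_of_cov₂ {W : Fin 4 → Site 4 → Fin 4 → Site 4 → MKer 4 F}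
    (hcovW : ∀ (μ : Fin 4) (y : Site 4) (ν : Fin 4) (y' t : Site 4), W μ (y + t) ν (y' + t) = shiftK (-t) (W μ y ν y'))
    (μ : Fin 4) (u : Site 4) (ν : Fin 4) (u' : Site 4) : W μ u ν u' = shiftK (-u) (W μ 0 ν (u' - u)) := by
  have h := hcovW μ 0 ν (u' - u) u
  rwa [zero_add, sub_add_cancel] at h

/-- [folklore] **FOR A TRANSLATION-INVARIANT LEG AND COVARIANT FAMILIES THE FINE HESSIAN TABLE IS THE REDUCED KERNEL AT THE DIFFERENCE**:
`fineHessA A V W κ′ l′ u u′ = hessKer A V W κ′ l′ (u′ − u)`. -/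
theorem fineHessA_eq_hessKer_of_cov [Nonempty F] {A : MKer 4 F} (hA : ∀ v : Site 4, shiftK v A = A)
    {V : Fin 4 → Site 4 → MKer 4 F} (hcovV : ∀ (μ : Fin 4) (y t : Site 4), V μ (y + t) = shiftK (-t) (V μ y))
    {W : Fin 4 → Site 4 → Fin 4 → Site 4 → MKer 4 F}
    (hcovW : ∀ (μ : Fin 4) (y : Site 4) (ν : Fin 4) (y' t : Site 4), W μ (y + t) ν (y' + t) = shiftK (-t) (W μ y ν y'))
    (κ' l' : Fin 4) (u u' : Site 4) :
    fineHessA A V W κ' l' u u' = hessKer A V W κ' l' (u' - u) := by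
  rw [fineHessA_apply, tadpoleTableA_apply, bubbleTableA_apply]
  have hW : W κ' u l' u' = shiftK (-u) (W κ' 0 l' (u' - u)) := shiftK_of_cov₂ hcovW κ' u l' u'
  have hV1 : V κ' u = shiftK (-u) (V κ' 0) := shiftK_of_cov hcovV κ' u
  have hV2 : V l' u' = shiftK (-u) (V l' (u' - u)) := by
    have h := hcovV l' (u' - u) u; rwa [sub_add_cancel] at h
  have hAu : shiftK (-u) A = A := hA (-u)
  rw [hW, hV1, hV2, ← hAu, tadpole_shiftK, bubble_shiftK, hAu]
  simp only [hessKer]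
  ring

/-! ## §2 The right member of `hfine` as fine Hessian tables -/

/-- [our object] **`PiBF` AT THE BOND DIFFERENCE IS A DIFFERENCE OF FINE HESSIAN TABLES AT THE BOND PAIR** (translation-covariant vertex data):
`PiBF wg wgh V W v w c e (s′ − s) = wg·fineHessA Pker V W c e s s′ − wgh·fineHessA G0ker v w c e s s′`. -/
theorem PiBF_eq_fineHessA (wg wgh : ℝ)
    {V : Fin 4 → Site 4 → MKer 4 (Fib 3)} (hcovV : ∀ (μ : Fin 4) (y t : Site 4), V μ (y + t) = shiftK (-t) (V μ y))
    {W : Fin 4 → Site 4 → Fin 4 → Site 4 → MKer 4 (Fib 3)}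
    (hcovW : ∀ (μ : Fin 4) (y : Site 4) (ν : Fin 4) (y' t : Site 4), W μ (y + t) ν (y' + t) = shiftK (-t) (W μ y ν y'))
    {v : Fin 4 → Site 4 → MKer 4 Unit} (hcovv : ∀ (μ : Fin 4) (y t : Site 4), v μ (y + t) = shiftK (-t) (v μ y))
    {w : Fin 4 → Site 4 → Fin 4 → Site 4 → MKer 4 Unit}
    (hcovw : ∀ (μ : Fin 4) (y : Site 4) (ν : Fin 4) (y' t : Site 4), w μ (y + t) ν (y' + t) = shiftK (-t) (w μ y ν y'))
    (c e : Fin 4) (s s' : Site 4) :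
    PiBF wg wgh V W v w c e (s' - s) = wg * fineHessA Pker V W c e s s' - wgh * fineHessA G0ker v w c e s s' := by
  rw [PiBF_def, fineHessA_eq_hessKer_of_cov Pker_translate hcovV hcovW, fineHessA_eq_hessKer_of_cov G0ker_translate hcovv hcovw]

/-- [our object] **THE RIGHT MEMBER OF THE JUNCTION'S `hfine` IN TABLE CURRENCY**: for translation-covariant vertex data and every `N`,
`N⁸·truncK (PiBF wg wgh V W v w) N c e (s′ − s) = (if ‖s′ − s‖∞ ≤ N then 1 else 0)·N⁸·( wg·fineHessA Pker V W c e s s′ − wgh·fineHessA G0ker v w c e s s′ )`. -/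
theorem truncK_PiBF_eq_fineHessA (wg wgh : ℝ) (N : ℕ) (r : ℝ)
    {V : Fin 4 → Site 4 → MKer 4 (Fib 3)} (hcovV : ∀ (μ : Fin 4) (y t : Site 4), V μ (y + t) = shiftK (-t) (V μ y))
    {W : Fin 4 → Site 4 → Fin 4 → Site 4 → MKer 4 (Fib 3)}
    (hcovW : ∀ (μ : Fin 4) (y : Site 4) (ν : Fin 4) (y' t : Site 4), W μ (y + t) ν (y' + t) = shiftK (-t) (W μ y ν y'))
    {v : Fin 4 → Site 4 → MKer 4 Unit} (hcovv : ∀ (μ : Fin 4) (y t : Site 4), v μ (y + t) = shiftK (-t) (v μ y))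
    {w : Fin 4 → Site 4 → Fin 4 → Site 4 → MKer 4 Unit}
    (hcovw : ∀ (μ : Fin 4) (y : Site 4) (ν : Fin 4) (y' t : Site 4), w μ (y + t) ν (y' + t) = shiftK (-t) (w μ y ν y'))
    (c e : Fin 4) (s s' : Site 4) :
    r * truncK (PiBF wg wgh V W v w) N c e (s' - s) =
      (if supNorm (s' - s) ≤ N then (1 : ℝ) else 0) * (r * (wg * fineHessA Pker V W c e s s' - wgh * fineHessA G0ker v w c e s s')) := by
  rw [truncK_apply]
  by_cases h : supNorm (s' - s) ≤ N
  · rw [if_pos h, if_pos h, PiBF_eq_fineHessA wg wgh hcovV hcovW hcovv hcovw, one_mul]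
  · rw [if_neg h, if_neg h]; simp

end Summit.QuantumFields.BalabanUV.Beta.FP.FineHessianTransportTable

end
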